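import Summits.Ventures.CertifiedManyBodySolver.Observables.StiffnessObliqueStation
import HarnessLib

/-!
# Ventures/CertifiedManyBodySolver — Observables/StiffnessObliqueStationBoxes.lean

HONEST FRAMING: one-sided certified CEILINGS on the uniform flux stiffness (t–t′ f-sum class) at ANY density from TWO certified energy floors at TWO
couplings and one cap at the target (line «OBLIQUE STATION», companion of `Observables/StiffnessObliqueStation.lean`); every leaf is CONDITIONAL on the
rows it names; a ceiling never speaks to the presence of order; not a `T_c` estimate, not a superconductivity verdict; no number of record. Zero compute,
no definition, no claim node, no `sorry`. Cell `pub/hubbard-fast` (D-0154 (1)(A)), seat `hubbard-fast-reuse-2` g11.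

THE POINT. For two variational floor rows `a = (s_a, U_a, lo_a)`, `b = (s_b, U_b, lo_b)` at DIFFERENT couplings the cleared LP-vertex weights of the
companion's `ObsStiffnessSeqCeilingAt_of_twoFloors_cap_cleared` — `E = U(s_b − s_a) + t′(U_a − U_b) + (U_b s_a − U_a s_b)`, `W_a = U s_b − t′(2U − U_b)`,
`W_b = t′(2U − U_a) − U s_a`, `Y = 2t′(U_b − U_a) + U_a s_b − U_b s_a` — are affine in `U` at fixed `t′` and in `t′` at fixed `U`, and `Y` depends on `t′`
only; with a cap AFFINE IN `U` on the box (a `t′`-dependent cap is frozen at its worst hopping by the caller) the word inequality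
`G = 4cE + W_a lo_a + W_b lo_b − Y(h₀ + h₁U)` is again bilinear, so four corner checks of each quantity word the whole box (`box_corner_interp`; strict
version `box_corner_interp_pos` for `E > 0`; §2 `affineCapU_on_box_of_bilinearCap` freezes a bilinear plane/secant cap into the affine-in-`U`
majorant through its corner maxima). Typical use at `n = 7/8`: a `t′ = 0` floor at a low station (`#568@2`, `#544@4`) paired with an oblique floor
(`#590 (7/2, 7/8, −3/10)`), the columns `t′ ∈ [−1/5, 0]` where no same-coupling oblique pair exists.

References: T. Koma, H. Tasaki, J. Stat. Phys. 76 (1994) 745, §1 [KomaTasaki1994]; D. J. Scalapino, S. R. White, S.-C. Zhang, PRB 47 (1993) 7995, §II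
[ScalapinoWhiteZhang1993].
-/

noncomputable section

namespace Summit.Ventures.CertifiedManyBodySolver.Observables

open Literature.MathematicalPhysics.QuantumLattice
open Literature.MathematicalPhysics.QuantumLattice.ThermodynamicLimit
open Literature.MathematicalPhysics.QuantumFieldTheory
open Literature.Probability.LatticeModels
open Matrix Finset Filter Topology HubbardWave0
open scoped Matrix BigOperators ComplexOrder

/-! ## §1 BOX WORD — two floors at two couplings, cap affine in `U` on the box -/

section BoxTwo

variable {n sa Ua loa sb Ub lob : ℝ}

/-- **Strict four-corner interpolation**: positive corner values with the bilinear weights of a point of a nondegenerate box sum to a positive number. [folklore] -/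
theorem box_corner_interp_pos {Ua' Ub' ta tb U t P₁ P₂ P₃ P₄ : ℝ} (hU : U ∈ Set.Icc Ua' Ub') (ht : t ∈ Set.Icc ta tb)
    (hab : Ua' < Ub') (htab : ta < tb) (h₁ : 0 < P₁) (h₂ : 0 < P₂) (h₃ : 0 < P₃) (h₄ : 0 < P₄) :
    0 < (Ub' - U) * (tb - t) * P₁ + (Ub' - U) * (t - ta) * P₂ + (U - Ua') * (tb - t) * P₃ + (U - Ua') * (t - ta) * P₄ := by
  obtain ⟨hUa, hUb⟩ := hU
  obtain ⟨hta, htb⟩ := ht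
  set m := min (min P₁ P₂) (min P₃ P₄) with hm
  have hm0 : 0 < m := lt_min (lt_min h₁ h₂) (lt_min h₃ h₄)
  have hm₁ : m ≤ P₁ := (min_le_left _ _).trans (min_le_left _ _)
  have hm₂ : m ≤ P₂ := (min_le_left _ _).trans (min_le_right _ _)
  have hm₃ : m ≤ P₃ := (min_le_right _ _).trans (min_le_left _ _)
  have hm₄ : m ≤ P₄ := (min_le_right _ _).trans (min_le_right _ _)
  have w₁ := mul_nonneg (sub_nonneg.2 hUb) (sub_nonneg.2 htb)
  have w₂ := mul_nonneg (sub_nonneg.2 hUb) (sub_nonneg.2 hta)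
  have w₃ := mul_nonneg (sub_nonneg.2 hUa) (sub_nonneg.2 htb)
  have w₄ := mul_nonneg (sub_nonneg.2 hUa) (sub_nonneg.2 hta)
  have e : (Ub' - U) * (tb - t) + (Ub' - U) * (t - ta) + (U - Ua') * (tb - t) + (U - Ua') * (t - ta) = (Ub' - Ua') * (tb - ta) := by ring
  have hS : 0 < (Ub' - Ua') * (tb - ta) := mul_pos (sub_pos.2 hab) (sub_pos.2 htab)
  have k₁ := mul_le_mul_of_nonneg_left hm₁ w₁
  have k₂ := mul_le_mul_of_nonneg_left hm₂ w₂
  have k₃ := mul_le_mul_of_nonneg_left hm₃ w₃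
  have k₄ := mul_le_mul_of_nonneg_left hm₄ w₄
  have hsum : m * ((Ub' - Ua') * (tb - ta)) ≤
      (Ub' - U) * (tb - t) * P₁ + (Ub' - U) * (t - ta) * P₂ + (U - Ua') * (tb - t) * P₃ + (U - Ua') * (t - ta) * P₄ := by
    rw [← e]; linarith
  exact lt_of_lt_of_le (mul_pos hm0 hS) hsum

/-- **BOX WORD, TWO FLOORS AT TWO COUPLINGS × CAP AFFINE IN `U`.** Floors `lo_a ≤ e(1, s_a, U_a, n)`, `lo_b ≤ e(1, s_b, U_b, n)` (`U_a, U_b ≥ 0`), a box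
`[U_l, U_r] × [t_a, t_b]` with `0 ≤ U_l < U_r`, `t_a < t_b`, a cap `e(1, t′, U, n) ≤ h₀ + h₁U` on the box (a `t′`-dependent cap is FROZEN at its worst hopping by
the caller); at the four corners: `E = U(s_b − s_a) + t′(U_a − U_b) + (U_b s_a − U_a s_b) > 0`, `W_a = U s_b − t′(2U − U_b) ≥ 0`, `W_b = t′(2U − U_a) − U s_a ≥ 0`,
and `G = 4cE + W_a lo_a + W_b lo_b − Y(h₀ + h₁U) ≥ 0` with `Y = 2t′(U_b − U_a) + U_a s_b − U_b s_a`; and `Y ≥ 0` at `t_a` and `t_b`. Then `ObsStiffnessSeqCeilingAt t′ U n c`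
on the whole box (every cleared quantity is affine in `U` at fixed `t′` and in `t′` at fixed `U`). [cite: KomaTasaki1994, §1] [cite: ScalapinoWhiteZhang1993, §II] -/
theorem ObsStiffnessSeqCeilingAt_on_box_of_twoFloors_affineCap (hn0 : 0 ≤ n) (hn2 : n < 2)
    (hUa0 : 0 ≤ Ua) (hfa : loa ≤ energyDensityTT' 1 sa Ua n) (hUb0 : 0 ≤ Ub) (hfb : lob ≤ energyDensityTT' 1 sb Ub n)
    {Ul Ur ta tb h₀ h₁ : ℝ} (hUl0 : 0 ≤ Ul) (hlr : Ul < Ur) (htab : ta < tb)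
    (hcapbox : ∀ U ∈ Set.Icc Ul Ur, ∀ t ∈ Set.Icc ta tb, energyDensityTT' 1 t U n ≤ h₀ + h₁ * U)
    (hE₁ : 0 < Ul * (sb - sa) + ta * (Ua - Ub) + (Ub * sa - Ua * sb)) (hE₂ : 0 < Ul * (sb - sa) + tb * (Ua - Ub) + (Ub * sa - Ua * sb))
    (hE₃ : 0 < Ur * (sb - sa) + ta * (Ua - Ub) + (Ub * sa - Ua * sb)) (hE₄ : 0 < Ur * (sb - sa) + tb * (Ua - Ub) + (Ub * sa - Ua * sb))
    (hWa₁ : 0 ≤ Ul * sb - ta * (2 * Ul - Ub)) (hWa₂ : 0 ≤ Ul * sb - tb * (2 * Ul - Ub))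
    (hWa₃ : 0 ≤ Ur * sb - ta * (2 * Ur - Ub)) (hWa₄ : 0 ≤ Ur * sb - tb * (2 * Ur - Ub))
    (hWb₁ : 0 ≤ ta * (2 * Ul - Ua) - Ul * sa) (hWb₂ : 0 ≤ tb * (2 * Ul - Ua) - Ul * sa)
    (hWb₃ : 0 ≤ ta * (2 * Ur - Ua) - Ur * sa) (hWb₄ : 0 ≤ tb * (2 * Ur - Ua) - Ur * sa)
    (hYa : 0 ≤ 2 * ta * (Ub - Ua) + Ua * sb - Ub * sa) (hYb : 0 ≤ 2 * tb * (Ub - Ua) + Ua * sb - Ub * sa) (c : ℚ)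
    (hG₁ : 0 ≤ 4 * ((c : ℚ) : ℝ) * (Ul * (sb - sa) + ta * (Ua - Ub) + (Ub * sa - Ua * sb)) +
      (Ul * sb - ta * (2 * Ul - Ub)) * loa + (ta * (2 * Ul - Ua) - Ul * sa) * lob - (2 * ta * (Ub - Ua) + Ua * sb - Ub * sa) * (h₀ + h₁ * Ul))
    (hG₂ : 0 ≤ 4 * ((c : ℚ) : ℝ) * (Ul * (sb - sa) + tb * (Ua - Ub) + (Ub * sa - Ua * sb)) +
      (Ul * sb - tb * (2 * Ul - Ub)) * loa + (tb * (2 * Ul - Ua) - Ul * sa) * lob - (2 * tb * (Ub - Ua) + Ua * sb - Ub * sa) * (h₀ + h₁ * Ul))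
    (hG₃ : 0 ≤ 4 * ((c : ℚ) : ℝ) * (Ur * (sb - sa) + ta * (Ua - Ub) + (Ub * sa - Ua * sb)) +
      (Ur * sb - ta * (2 * Ur - Ub)) * loa + (ta * (2 * Ur - Ua) - Ur * sa) * lob - (2 * ta * (Ub - Ua) + Ua * sb - Ub * sa) * (h₀ + h₁ * Ur))
    (hG₄ : 0 ≤ 4 * ((c : ℚ) : ℝ) * (Ur * (sb - sa) + tb * (Ua - Ub) + (Ub * sa - Ua * sb)) +
      (Ur * sb - tb * (2 * Ur - Ub)) * loa + (tb * (2 * Ur - Ua) - Ur * sa) * lob - (2 * tb * (Ub - Ua) + Ua * sb - Ub * sa) * (h₀ + h₁ * Ur)) :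
    ∀ U ∈ Set.Icc Ul Ur, ∀ t ∈ Set.Icc ta tb, ObsStiffnessSeqCeilingAt t U n c := by
  intro U hU t ht
  have hU0 : 0 ≤ U := hUl0.trans hU.1
  have hpos : 0 < (Ur - Ul) * (tb - ta) := mul_pos (sub_pos.2 hlr) (sub_pos.2 htab)
  have hE : 0 < U * (sb - sa) + t * (Ua - Ub) + (Ub * sa - Ua * sb) := by
    have h := box_corner_interp_pos hU ht hlr htab hE₁ hE₂ hE₃ hE₄
    have key : (Ur - Ul) * (tb - ta) * (U * (sb - sa) + t * (Ua - Ub) + (Ub * sa - Ua * sb)) =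
        (Ur - U) * (tb - t) * (Ul * (sb - sa) + ta * (Ua - Ub) + (Ub * sa - Ua * sb)) + (Ur - U) * (t - ta) * (Ul * (sb - sa) + tb * (Ua - Ub) + (Ub * sa - Ua * sb)) +
        (U - Ul) * (tb - t) * (Ur * (sb - sa) + ta * (Ua - Ub) + (Ub * sa - Ua * sb)) + (U - Ul) * (t - ta) * (Ur * (sb - sa) + tb * (Ua - Ub) + (Ub * sa - Ua * sb)) := by
      ring
    have hp : 0 < (Ur - Ul) * (tb - ta) * (U * (sb - sa) + t * (Ua - Ub) + (Ub * sa - Ua * sb)) := by rw [key]; exact h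
    exact (mul_pos_iff_of_pos_left hpos).1 hp
  have hWa : 0 ≤ U * sb - t * (2 * U - Ub) := by
    have h := box_corner_interp hU ht hWa₁ hWa₂ hWa₃ hWa₄
    have key : (Ur - Ul) * (tb - ta) * (U * sb - t * (2 * U - Ub)) =
        (Ur - U) * (tb - t) * (Ul * sb - ta * (2 * Ul - Ub)) + (Ur - U) * (t - ta) * (Ul * sb - tb * (2 * Ul - Ub)) +
        (U - Ul) * (tb - t) * (Ur * sb - ta * (2 * Ur - Ub)) + (U - Ul) * (t - ta) * (Ur * sb - tb * (2 * Ur - Ub)) := by ring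
    have hnn : 0 ≤ (Ur - Ul) * (tb - ta) * (U * sb - t * (2 * U - Ub)) := by rw [key]; exact h
    exact (mul_nonneg_iff_of_pos_left hpos).1 hnn
  have hWb : 0 ≤ t * (2 * U - Ua) - U * sa := by
    have h := box_corner_interp hU ht hWb₁ hWb₂ hWb₃ hWb₄
    have key : (Ur - Ul) * (tb - ta) * (t * (2 * U - Ua) - U * sa) =
        (Ur - U) * (tb - t) * (ta * (2 * Ul - Ua) - Ul * sa) + (Ur - U) * (t - ta) * (tb * (2 * Ul - Ua) - Ul * sa) +
        (U - Ul) * (tb - t) * (ta * (2 * Ur - Ua) - Ur * sa) + (U - Ul) * (t - ta) * (tb * (2 * Ur - Ua) - Ur * sa) := by ring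
    have hnn : 0 ≤ (Ur - Ul) * (tb - ta) * (t * (2 * U - Ua) - U * sa) := by rw [key]; exact h
    exact (mul_nonneg_iff_of_pos_left hpos).1 hnn
  have hY : 0 ≤ 2 * t * (Ub - Ua) + Ua * sb - Ub * sa := by
    -- affine in t: interpolate between ta and tb
    obtain ⟨hta, htb⟩ := ht
    have key : (tb - ta) * (2 * t * (Ub - Ua) + Ua * sb - Ub * sa) =
        (tb - t) * (2 * ta * (Ub - Ua) + Ua * sb - Ub * sa) + (t - ta) * (2 * tb * (Ub - Ua) + Ua * sb - Ub * sa) := by ring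
    have hnn : 0 ≤ (tb - ta) * (2 * t * (Ub - Ua) + Ua * sb - Ub * sa) := by
      rw [key]
      exact add_nonneg (mul_nonneg (sub_nonneg.2 htb) hYa) (mul_nonneg (sub_nonneg.2 hta) hYb)
    exact (mul_nonneg_iff_of_pos_left (sub_pos.2 htab)).1 hnn
  have hG : 0 ≤ 4 * ((c : ℚ) : ℝ) * (U * (sb - sa) + t * (Ua - Ub) + (Ub * sa - Ua * sb)) +
      (U * sb - t * (2 * U - Ub)) * loa + (t * (2 * U - Ua) - U * sa) * lob - (2 * t * (Ub - Ua) + Ua * sb - Ub * sa) * (h₀ + h₁ * U) := by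
    have h := box_corner_interp hU ht hG₁ hG₂ hG₃ hG₄
    have key : (Ur - Ul) * (tb - ta) * (4 * ((c : ℚ) : ℝ) * (U * (sb - sa) + t * (Ua - Ub) + (Ub * sa - Ua * sb)) +
        (U * sb - t * (2 * U - Ub)) * loa + (t * (2 * U - Ua) - U * sa) * lob - (2 * t * (Ub - Ua) + Ua * sb - Ub * sa) * (h₀ + h₁ * U)) =
        (Ur - U) * (tb - t) * (4 * ((c : ℚ) : ℝ) * (Ul * (sb - sa) + ta * (Ua - Ub) + (Ub * sa - Ua * sb)) +
          (Ul * sb - ta * (2 * Ul - Ub)) * loa + (ta * (2 * Ul - Ua) - Ul * sa) * lob - (2 * ta * (Ub - Ua) + Ua * sb - Ub * sa) * (h₀ + h₁ * Ul)) +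
        (Ur - U) * (t - ta) * (4 * ((c : ℚ) : ℝ) * (Ul * (sb - sa) + tb * (Ua - Ub) + (Ub * sa - Ua * sb)) +
          (Ul * sb - tb * (2 * Ul - Ub)) * loa + (tb * (2 * Ul - Ua) - Ul * sa) * lob - (2 * tb * (Ub - Ua) + Ua * sb - Ub * sa) * (h₀ + h₁ * Ul)) +
        (U - Ul) * (tb - t) * (4 * ((c : ℚ) : ℝ) * (Ur * (sb - sa) + ta * (Ua - Ub) + (Ub * sa - Ua * sb)) +
          (Ur * sb - ta * (2 * Ur - Ub)) * loa + (ta * (2 * Ur - Ua) - Ur * sa) * lob - (2 * ta * (Ub - Ua) + Ua * sb - Ub * sa) * (h₀ + h₁ * Ur)) +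
        (U - Ul) * (t - ta) * (4 * ((c : ℚ) : ℝ) * (Ur * (sb - sa) + tb * (Ua - Ub) + (Ub * sa - Ua * sb)) +
          (Ur * sb - tb * (2 * Ur - Ub)) * loa + (tb * (2 * Ur - Ua) - Ur * sa) * lob - (2 * tb * (Ub - Ua) + Ua * sb - Ub * sa) * (h₀ + h₁ * Ur)) := by
      ring
    have hnn : 0 ≤ (Ur - Ul) * (tb - ta) * (4 * ((c : ℚ) : ℝ) * (U * (sb - sa) + t * (Ua - Ub) + (Ub * sa - Ua * sb)) +
        (U * sb - t * (2 * U - Ub)) * loa + (t * (2 * U - Ua) - U * sa) * lob - (2 * t * (Ub - Ua) + Ua * sb - Ub * sa) * (h₀ + h₁ * U)) := by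
      rw [key]; exact h
    exact (mul_nonneg_iff_of_pos_left hpos).1 hnn
  exact ObsStiffnessSeqCeilingAt_of_twoFloors_cap_cleared hU0 hn0 hn2 hUa0 hfa hUb0 hfb (hcapbox U hU t ht) hE hWa hWb hY c hG

/-! ## §2 A cap affine in `U` from a bilinear cap on the box (the `hcapbox` input of §1) -/

/-- **AFFINE-IN-`U` MAJORANT OF A BILINEAR CAP.** If `e(1, t′, U, n) ≤ h₀ + h₁U + h₂t′ + h₃Ut′` on the box and the affine `g₀ + g₁U` dominates that bilinear
form at the four corners, then `e(1, t′, U, n) ≤ g₀ + g₁U` on the box (the difference is bilinear, so its sign interpolates from the corners;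
`box_corner_interp`). Used to FREEZE a `t′`-dependent plane/secant cap for the two-coupling box theorem. [folklore] -/
theorem affineCapU_on_box_of_bilinearCap {Ul Ur ta tb h₀ h₁ h₂ h₃ g₀ g₁ : ℝ} (hlr : Ul < Ur) (htab : ta < tb)
    (hcapbox : ∀ U ∈ Set.Icc Ul Ur, ∀ t ∈ Set.Icc ta tb, energyDensityTT' 1 t U n ≤ h₀ + h₁ * U + h₂ * t + h₃ * U * t)
    (h₁' : h₀ + h₁ * Ul + h₂ * ta + h₃ * Ul * ta ≤ g₀ + g₁ * Ul) (h₂' : h₀ + h₁ * Ul + h₂ * tb + h₃ * Ul * tb ≤ g₀ + g₁ * Ul)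
    (h₃' : h₀ + h₁ * Ur + h₂ * ta + h₃ * Ur * ta ≤ g₀ + g₁ * Ur) (h₄' : h₀ + h₁ * Ur + h₂ * tb + h₃ * Ur * tb ≤ g₀ + g₁ * Ur) :
    ∀ U ∈ Set.Icc Ul Ur, ∀ t ∈ Set.Icc ta tb, energyDensityTT' 1 t U n ≤ g₀ + g₁ * U := by
  intro U hU t ht
  have hpos : 0 < (Ur - Ul) * (tb - ta) := mul_pos (sub_pos.2 hlr) (sub_pos.2 htab)
  have h := box_corner_interp hU ht (sub_nonneg.2 h₁') (sub_nonneg.2 h₂') (sub_nonneg.2 h₃') (sub_nonneg.2 h₄')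
  have key : (Ur - Ul) * (tb - ta) * (g₀ + g₁ * U - (h₀ + h₁ * U + h₂ * t + h₃ * U * t)) =
      (Ur - U) * (tb - t) * (g₀ + g₁ * Ul - (h₀ + h₁ * Ul + h₂ * ta + h₃ * Ul * ta)) + (Ur - U) * (t - ta) * (g₀ + g₁ * Ul - (h₀ + h₁ * Ul + h₂ * tb + h₃ * Ul * tb)) +
      (U - Ul) * (tb - t) * (g₀ + g₁ * Ur - (h₀ + h₁ * Ur + h₂ * ta + h₃ * Ur * ta)) + (U - Ul) * (t - ta) * (g₀ + g₁ * Ur - (h₀ + h₁ * Ur + h₂ * tb + h₃ * Ur * tb)) := by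
    ring
  have hnn : 0 ≤ (Ur - Ul) * (tb - ta) * (g₀ + g₁ * U - (h₀ + h₁ * U + h₂ * t + h₃ * U * t)) := by rw [key]; exact h
  have := (mul_nonneg_iff_of_pos_left hpos).1 hnn
  linarith [hcapbox U hU t ht]

end BoxTwo


end Summit.Ventures.CertifiedManyBodySolver.Observables

end
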